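import Summits.ABC.IUTFork.Repair.RHSigmaLicenceInvariance
import Summits.ABC.IUTFork.Repair.RHSigmaStrataEqGenuine
import Summits.ABC.IUTFork.Repair.RHSigmaStrataEqAbc
import Summits.ABC.IUTFork.Repair.RHTameBandLicenceSigmaBall
import HarnessLib

/-!
# R-H ROUND 2, Q2 rows 3/4/5 at the genuine bed: ALL licensed strata pay ONE number — `R_{Σ₄} = R_{Σ₅} = R_{Σ₅♭} = R_∅(T)`, the total positive deficit

abc-iut cell, rung LADDER-ABC:A2.RESCUE.H, R-H ROUND 2 seat abc-iut-rh2-q2-eq (gen 2; rows 3/4/5 = the EQUIVALENCE / locator rows, Σ = HullCell-POS /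
tame-ball strata). Bed-level companion of `RHSigmaLicenceInvariance.lean` (generic: `LicenceOn P σ ⟹ offRemainder P σ = offRemainder P ∅`,
`R_σ + R_{σᶜ} = R_∅`, strictness) — instantiated at abc-iut-c312-7's sharp print-normalised setting `settingPrVolSharp X …` with ideles non-zero
and units off `S` (bridge hypotheses: abc-iut-w4-d128's `bridgeHyps_settingPrVolSharp_of_ideles`), for the strata of record:
Σ₄ = `sigmaNu` (gen 0, p470233), Σ₃ = `sigmaED` (gen 0, p470530), Σ₅ = `sigmaFive` / Σ₅♭ = `sigmaFiveBall` (abc-iut-rh-typ-5, p472055 / p473920).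

RESULTS (all PROVED, standard axioms; `R_σ := offRemainder P σ`, `R_∅ = PN(i ↦ Σᶠ_{v_ℚ} (cellDeficit)⁺)` the total positive deficit):
* §1 ROW 4: **`offRemainder_sigmaNu_eq_offRemainder_empty`** — `R_{Σ₄} = R_∅` (the number ALL of gen 0's certificates carry IS the total positive
  deficit); `offRemainder_eq_offRemainder_sigmaNu_of_licenceOn` — EVERY licensed `σ` pays exactly `R_{Σ₄}` (gen 0's `offRemainder_sigmaNu_le` upgraded
  to an equality); `offRemainder_le_offRemainder_sigmaNu` — and EVERY stratum whatsoever pays at most `R_{Σ₄}`.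
* §1 ROW 3: `offRemainder_sigmaED_add_compl` — `R_{Σ₃} + R_{Σ₃ᶜ} = R_{Σ₄}`; **`offRemainder_sigmaED_eq_sigmaNu_iff`** — `R_{Σ₃} = R_{Σ₄} ⟺` no [ED]-cell has
  a positive deficit (strict `<` otherwise): the [ED] row's weakened Corollary «up to `R_{Σ₃}`» is STRICTLY STRONGER than the proved sentence exactly
  when some [ED]-passed cell has a positive deficit — that set of cells, not Σ₃ vs Σ₄ membership, is the row's residual content.
* §2 ROW 5: **`sigmaFive_subset_sigmaNu`, `sigmaFiveBall_subset_sigmaNu`** — Σ₅ ⊆ Σ₅♭ ⊆ Σ₄ (typ-5's licensed strata sit inside the exact licence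
  stratum); **`offRemainder_sigmaFive_eq_sigmaNu`, `offRemainder_sigmaFiveBall_eq_sigmaNu`, `offRemainder_sigmaFiveBall_eq_sigmaFive`** — `R_{Σ₅} =
  R_{Σ₅♭} = R_{Σ₄}` (typ-5's `offRemainder_sigmaFiveBall_le_sigmaFive` upgraded to an equality): rows 4 and 5 weaken Cor. 3.12 by THE SAME number.
* §3 T-LEVEL at the CHOSEN realising ideles of the window certificates: `offRemainder_sigmaNu_chosen_eq_offRemainder_empty` and
  **`cor312UpTo_offRemainder_empty_chosen`** — `−|log(q)|(T) ≤ −|log(Θ)|(T) + R_∅(T)` at every genuine Θ-volume datum, no stratum, no S_H, no H⋆;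
  hence every abc-end of record (gen 0 p471150/p471805/p473201/p473438/p473701, typ-5 p472385) has ONE binder in common: a tolerance on `R_∅(T)`.
HONEST FRAMING: reading predicates and numbers about OUR typed objects; nothing here asserts that abc is proved or refuted, or that [IUTchIII] Cor. 3.12
holds or fails at any datum, or takes a side on any author; `R_∅(T)` is DEFINED and identified across rows, never bounded numerically here; typed ≠ proved;
refuted-as-typed ≠ refuted-in-print. [claim: Mochizuki2012, status: disputed] for every IUT locution. [cite: Mochizuki2012, IUTchIII Cor. 3.12 p. 173–174,
Step (xi-f) p. 184, Rmk. 3.9.5 (i) p. 127; IUTchIV Prop. 1.2 (i)(ii) p. 10] [cite: DupuyHilado2025, §3.4, §3.9, §4.9, §4.12]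
-/

noncomputable section

open Set Function NumberField IsDedekindDomain
open scoped Pointwise

namespace Summit.ABC.IUTFork.Repair.RH.SigmaStrataEq

open Summit.ABC.IUTFork.Thm311 Summit.ABC.IUTFork.Thm311.Real Summit.ABC.IUTFork.Cor312 Summit.ABC.IUTFork.Cor312.Setting
  Summit.ABC.IUTFork.Cor312Vol Summit.ABC.IUTFork.Cor312Prov Literature.IUT.LogThetaLattice Literature.IUT.LogVolume
  Literature.IUT.HodgeTheaters Literature.IUT.LogVolume.ThetaData
  Summit.ABC.IUTFork.Repair.RH.SigmaLicence Summit.ABC.IUTFork.Repair.RH.TameBandLicence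
  Summit.ABC.IUTFork.Repair.RH.TameBandLicenceSigma Summit.ABC.IUTFork.Repair.RH.TameBandLicenceSigmaBall

/-! ## §1. ROW 4 and ROW 3 at the sharp print-normalised setting of any Dupuy–Hilado pilot datum (ideles non-zero, units off `S`) -/

section RowFour

variable {F : Type} [Field F] [NumberField F] (X : PilotData F) {logv : PadicLogs F} (hlog : LogvAnalytic logv)
  (M : Type) [Field M] [NumberField M]
  (archPk : ∀ (j : (thetaIndex X).Label) (vQ : (thetaIndex X).VQ), Set ((logShellsDH X logv).Packet j vQ))
  (archSub : ∀ (j : (thetaIndex X).Label) (v : (thetaIndex X).V),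
    Set ((logShellsDH X logv).Packet j ((thetaIndex X).over v)))
  (Ψ : ℤ → ∀ v : (thetaIndex X).V, v ∈ (thetaIndex X).Vbad → Set ((logShellsDH X logv).StarPacket v))
  (act : ℤ → ∀ v : (thetaIndex X).V, v ∈ (thetaIndex X).Vbad →
    (logShellsDH X logv).StarPacket v → Module.End ℚ ((logShellsDH X logv).StarPacket v))
  (Mmod : ℤ → ∀ j : (thetaIndex X).LabelStar, Set ((logShellsDH X logv).GlobalPacket j.1))
  (region : ℤ → ∀ j : (thetaIndex X).LabelStar, FinDivisor M → ∀ vQ : (thetaIndex X).VQ,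
    Set ((logShellsDH X logv).Packet j.1 vQ))
  (n : ℤ) {HT : Type} {LogLink : HT → HT → Type} {IsFull : ∀ {s t : HT}, LogLink s t → Prop}
  (lat : LGPGaussianLogThetaLattice LogLink IsFull)
  {Frd : Type} {IsoF : Frd → Frd → Type} {Ob : Frd → Type} {realify : Frd → Frd} {Strip : Type}
  {IsoS : Strip → Strip → Type} {Mv : ∀ v : (thetaIndex X).V, v ∈ (thetaIndex X).Vbad → Type}
  [∀ v h, Monoid (Mv v h)]
  (sig : GlobalLGPFrobenioidSignature (thetaIndex X).lstar (thetaIndex X).V (· ∈ (thetaIndex X).Vbad)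
    Frd IsoF Ob realify Strip IsoS Mv)
  (split : SplittingMonoids Mv) {ObΔ : Type} {N : ∀ v : (thetaIndex X).V, v ∈ (thetaIndex X).Vbad → Type}
  [∀ v h, Monoid (N v h)] (qData : QPilotData ObΔ N)
  (tq : ∀ (pp : Nat.Primes) (x : (thetaIndex X).Fibre (.inr pp)), haveI : Fact (pp : ℕ).Prime := ⟨pp.2⟩; kOf X pp.1 x)
  (t : ∀ (pp : Nat.Primes) (_ : Fin X.lstar) (x : (thetaIndex X).Fibre (.inr pp)),
    haveI : Fact (pp : ℕ).Prime := ⟨pp.2⟩; kOf X pp.1 x)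
  (htq0 : ∀ pp x, tq pp x ≠ 0)
  (htq1 : ∀ (pp : Nat.Primes) (x : (thetaIndex X).Fibre (.inr pp)),
    haveI : Fact (pp : ℕ).Prime := ⟨pp.2⟩; placeOf X pp.1 x ∉ X.S → ‖tq pp x‖ = 1)
  (ht0 : ∀ pp i x, t pp i x ≠ 0)
  (ht1 : ∀ (pp : Nat.Primes) (i : Fin X.lstar) (x : (thetaIndex X).Fibre (.inr pp)),
    haveI : Fact (pp : ℕ).Prime := ⟨pp.2⟩; placeOf X pp.1 x ∉ X.S → ‖t pp i x‖ = 1)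

include ht0 ht1 in
/-- **ROW 4: `R_{Σ₄} = R_∅` — the off-Σ₄ remainder of every certificate of record IS the total positive cell deficit** (Σ₄ is licensed,
`licenceOn_sigmaNu`; invariance `offRemainder_eq_offRemainder_empty_of_licenceOn`). [claim: Mochizuki2012, status: disputed] -/
theorem offRemainder_sigmaNu_eq_offRemainder_empty :
    offRemainder (settingPrVolSharp X hlog M archPk archSub Ψ act Mmod region n lat sig split qData tq t htq0 htq1)
        (sigmaNu X hlog M archPk archSub Ψ act Mmod region n lat sig split qData tq t htq0 htq1) =
      offRemainder (settingPrVolSharp X hlog M archPk archSub Ψ act Mmod region n lat sig split qData tq t htq0 htq1) ∅ :=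
  offRemainder_eq_offRemainder_empty_of_licenceOn
    (bridgeHyps_settingPrVolSharp_of_ideles X hlog M archPk archSub Ψ act Mmod region n lat sig split qData t tq ht0 ht1 htq0 htq1)
    (licenceOn_sigmaNu X hlog M archPk archSub Ψ act Mmod region n lat sig split qData tq t htq0 htq1 ht0)

include ht0 ht1 in
/-- **EVERY licensed stratum pays exactly `R_{Σ₄}`** (gen 0's `offRemainder_sigmaNu_le`, «Σ₄ is the least charge», upgraded to an EQUALITY: among
licensed strata there is only one charge). [claim: Mochizuki2012, status: disputed] -/
theorem offRemainder_eq_offRemainder_sigmaNu_of_licenceOn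
    {σ : Set (Fin (thetaIndex X).lstar × (thetaIndex X).VQ)}
    (hσ : LicenceOn (settingPrVolSharp X hlog M archPk archSub Ψ act Mmod region n lat sig split qData tq t htq0 htq1) σ) :
    offRemainder (settingPrVolSharp X hlog M archPk archSub Ψ act Mmod region n lat sig split qData tq t htq0 htq1) σ =
      offRemainder (settingPrVolSharp X hlog M archPk archSub Ψ act Mmod region n lat sig split qData tq t htq0 htq1)
        (sigmaNu X hlog M archPk archSub Ψ act Mmod region n lat sig split qData tq t htq0 htq1) :=
  offRemainder_eq_of_licenceOn
    (bridgeHyps_settingPrVolSharp_of_ideles X hlog M archPk archSub Ψ act Mmod region n lat sig split qData t tq ht0 ht1 htq0 htq1) hσ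
    (licenceOn_sigmaNu X hlog M archPk archSub Ψ act Mmod region n lat sig split qData tq t htq0 htq1 ht0)

include ht0 ht1 in
/-- **EVERY stratum pays AT MOST `R_{Σ₄}`** (licensed or not): `R_σ ≤ R_∅ = R_{Σ₄}`. [claim: Mochizuki2012, status: disputed] -/
theorem offRemainder_le_offRemainder_sigmaNu (σ : Set (Fin (thetaIndex X).lstar × (thetaIndex X).VQ)) :
    offRemainder (settingPrVolSharp X hlog M archPk archSub Ψ act Mmod region n lat sig split qData tq t htq0 htq1) σ ≤
      offRemainder (settingPrVolSharp X hlog M archPk archSub Ψ act Mmod region n lat sig split qData tq t htq0 htq1)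
        (sigmaNu X hlog M archPk archSub Ψ act Mmod region n lat sig split qData tq t htq0 htq1) := by
  rw [offRemainder_sigmaNu_eq_offRemainder_empty X hlog M archPk archSub Ψ act Mmod region n lat sig split qData tq t htq0 htq1 ht0 ht1]
  exact offRemainder_le_offRemainder_empty
    (bridgeHyps_settingPrVolSharp_of_ideles X hlog M archPk archSub Ψ act Mmod region n lat sig split qData t tq ht0 ht1 htq0 htq1) σ

include ht0 ht1 in
/-- Row 4's hypothesis-free kernel target restated WITHOUT a stratum: Cor. 3.12 weakened by the total positive deficit `R_∅` at the bed
(= gen 0's `statementUpTo_offRemainder_sigmaNu`, same number). [claim: Mochizuki2012, status: disputed] -/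
theorem statementUpTo_offRemainder_empty_settingPrVolSharp :
    StatementUpTo (settingPrVolSharp X hlog M archPk archSub Ψ act Mmod region n lat sig split qData tq t htq0 htq1)
      (offRemainder (settingPrVolSharp X hlog M archPk archSub Ψ act Mmod region n lat sig split qData tq t htq0 htq1) ∅) :=
  statementUpTo_offRemainder_empty
    (bridgeHyps_settingPrVolSharp_of_ideles X hlog M archPk archSub Ψ act Mmod region n lat sig split qData t tq ht0 ht1 htq0 htq1)

include ht0 ht1 in
/-- **ROW 3 vs ROW 4: `R_{Σ₃} + R_{Σ₃ᶜ} = R_{Σ₄}`** — the [ED] row's remainder plus the positive deficit ON the [ED]-cells is row 4's number.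
[claim: Mochizuki2012, status: disputed] -/
theorem offRemainder_sigmaED_add_compl :
    offRemainder (settingPrVolSharp X hlog M archPk archSub Ψ act Mmod region n lat sig split qData tq t htq0 htq1) (sigmaED X hlog) +
        offRemainder (settingPrVolSharp X hlog M archPk archSub Ψ act Mmod region n lat sig split qData tq t htq0 htq1) (sigmaED X hlog)ᶜ =
      offRemainder (settingPrVolSharp X hlog M archPk archSub Ψ act Mmod region n lat sig split qData tq t htq0 htq1)
        (sigmaNu X hlog M archPk archSub Ψ act Mmod region n lat sig split qData tq t htq0 htq1) := by
  rw [offRemainder_sigmaNu_eq_offRemainder_empty X hlog M archPk archSub Ψ act Mmod region n lat sig split qData tq t htq0 htq1 ht0 ht1]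
  exact offRemainder_add_offRemainder_compl
    (bridgeHyps_settingPrVolSharp_of_ideles X hlog M archPk archSub Ψ act Mmod region n lat sig split qData t tq ht0 ht1 htq0 htq1) _

include ht0 ht1 in
/-- **ROW 3 vs ROW 4: `R_{Σ₃} = R_{Σ₄} ⟺` no [ED]-cell has a positive deficit.** So «S|Σ₃» (⟺ Σ₃ = Σ₄, gen 0) is SUFFICIENT but not necessary for
the two rows' weakened Corollaries to coincide; what separates them is exactly the set of [ED]-passed cells with a positive deficit.
[claim: Mochizuki2012, status: disputed] -/
theorem offRemainder_sigmaED_eq_sigmaNu_iff :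
    offRemainder (settingPrVolSharp X hlog M archPk archSub Ψ act Mmod region n lat sig split qData tq t htq0 htq1) (sigmaED X hlog) =
        offRemainder (settingPrVolSharp X hlog M archPk archSub Ψ act Mmod region n lat sig split qData tq t htq0 htq1)
          (sigmaNu X hlog M archPk archSub Ψ act Mmod region n lat sig split qData tq t htq0 htq1) ↔
      ∀ c ∈ sigmaED X hlog,
        cellDeficit (settingPrVolSharp X hlog M archPk archSub Ψ act Mmod region n lat sig split qData tq t htq0 htq1) c.1 c.2 ≤ 0 := by
  rw [offRemainder_sigmaNu_eq_offRemainder_empty X hlog M archPk archSub Ψ act Mmod region n lat sig split qData tq t htq0 htq1 ht0 ht1]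
  exact offRemainder_eq_offRemainder_empty_iff
    (bridgeHyps_settingPrVolSharp_of_ideles X hlog M archPk archSub Ψ act Mmod region n lat sig split qData t tq ht0 ht1 htq0 htq1) _

include ht0 ht1 in
/-- **ROW 3 vs ROW 4, strict form**: an [ED]-passed cell with a positive deficit makes `R_{Σ₃} < R_{Σ₄}` (then «Cor. 3.12 up to `R_{Σ₃}`» is NOT the
proved sentence, and row 3's hypothesis S|Σ₃ fails at this bed). [claim: Mochizuki2012, status: disputed] -/
theorem offRemainder_sigmaED_lt_sigmaNu_of_pos {c : Fin (thetaIndex X).lstar × (thetaIndex X).VQ} (hc : c ∈ sigmaED X hlog)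
    (hpos : 0 < cellDeficit (settingPrVolSharp X hlog M archPk archSub Ψ act Mmod region n lat sig split qData tq t htq0 htq1) c.1 c.2) :
    offRemainder (settingPrVolSharp X hlog M archPk archSub Ψ act Mmod region n lat sig split qData tq t htq0 htq1) (sigmaED X hlog) <
      offRemainder (settingPrVolSharp X hlog M archPk archSub Ψ act Mmod region n lat sig split qData tq t htq0 htq1)
        (sigmaNu X hlog M archPk archSub Ψ act Mmod region n lat sig split qData tq t htq0 htq1) := by
  rw [offRemainder_sigmaNu_eq_offRemainder_empty X hlog M archPk archSub Ψ act Mmod region n lat sig split qData tq t htq0 htq1 ht0 ht1]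
  exact offRemainder_lt_offRemainder_empty_of_pos
    (bridgeHyps_settingPrVolSharp_of_ideles X hlog M archPk archSub Ψ act Mmod region n lat sig split qData t tq ht0 ht1 htq0 htq1) hc hpos

include ht0 ht1 in
/-- A cell with a positive deficit lies OFF Σ₄ (its ν-cell fails). [claim: Mochizuki2012, status: disputed] -/
theorem notMem_sigmaNu_of_pos {c : Fin (thetaIndex X).lstar × (thetaIndex X).VQ}
    (hpos : 0 < cellDeficit (settingPrVolSharp X hlog M archPk archSub Ψ act Mmod region n lat sig split qData tq t htq0 htq1) c.1 c.2) :
    c ∉ sigmaNu X hlog M archPk archSub Ψ act Mmod region n lat sig split qData tq t htq0 htq1 := by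
  rw [sigmaNu_eq_licenceCells X hlog M archPk archSub Ψ act Mmod region n lat sig split qData tq t htq0 htq1 ht0]
  exact notMem_licenceCells_of_pos
    (bridgeHyps_settingPrVolSharp_of_ideles X hlog M archPk archSub Ψ act Mmod region n lat sig split qData t tq ht0 ht1 htq0 htq1) hpos

end RowFour

/-! ## §2. ROW 5 at the genuine `K`-level datum with REALISING ideles: Σ₅ ⊆ Σ₅♭ ⊆ Σ₄ and `R_{Σ₅} = R_{Σ₅♭} = R_{Σ₄}` -/

section RowFive

variable {F K Fbar : Type} [Field F] [NumberField F] [Field K] [NumberField K] [Algebra F K] [Field Fbar]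
  [Algebra F Fbar] [Algebra K Fbar] {E : WeierstrassCurve F} [E.IsElliptic] {l : ℕ} {Pb : BadPlacePredicates K}
  (D : InitialThetaData F K Fbar E l Pb) {logv : PadicLogs K} (hlog : LogvAnalytic logv)
  (M : Type) [Field M] [NumberField M]
  (archPk : ∀ (j : (thetaIndex (pilotDataOfK D K)).Label) (vQ : (thetaIndex (pilotDataOfK D K)).VQ),
    Set ((logShellsDH (pilotDataOfK D K) logv).Packet j vQ))
  (archSub : ∀ (j : (thetaIndex (pilotDataOfK D K)).Label) (v : (thetaIndex (pilotDataOfK D K)).V),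
    Set ((logShellsDH (pilotDataOfK D K) logv).Packet j ((thetaIndex (pilotDataOfK D K)).over v)))
  (Ψ : ℤ → ∀ v : (thetaIndex (pilotDataOfK D K)).V, v ∈ (thetaIndex (pilotDataOfK D K)).Vbad →
    Set ((logShellsDH (pilotDataOfK D K) logv).StarPacket v))
  (act : ℤ → ∀ v : (thetaIndex (pilotDataOfK D K)).V, v ∈ (thetaIndex (pilotDataOfK D K)).Vbad →
    (logShellsDH (pilotDataOfK D K) logv).StarPacket v → Module.End ℚ ((logShellsDH (pilotDataOfK D K) logv).StarPacket v))
  (Mmod : ℤ → ∀ j : (thetaIndex (pilotDataOfK D K)).LabelStar, Set ((logShellsDH (pilotDataOfK D K) logv).GlobalPacket j.1))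
  (region : ℤ → ∀ j : (thetaIndex (pilotDataOfK D K)).LabelStar, FinDivisor M → ∀ vQ : (thetaIndex (pilotDataOfK D K)).VQ,
    Set ((logShellsDH (pilotDataOfK D K) logv).Packet j.1 vQ))
  (n : ℤ) {HT : Type} {LogLink : HT → HT → Type} {IsFull : ∀ {s t : HT}, LogLink s t → Prop}
  (lat : LGPGaussianLogThetaLattice LogLink IsFull)
  {Frd : Type} {IsoF : Frd → Frd → Type} {Ob : Frd → Type} {realify : Frd → Frd} {Strip : Type}
  {IsoS : Strip → Strip → Type} {Mv : ∀ v : (thetaIndex (pilotDataOfK D K)).V, v ∈ (thetaIndex (pilotDataOfK D K)).Vbad → Type}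
  [∀ v h, Monoid (Mv v h)]
  (sig : GlobalLGPFrobenioidSignature (thetaIndex (pilotDataOfK D K)).lstar (thetaIndex (pilotDataOfK D K)).V
    (· ∈ (thetaIndex (pilotDataOfK D K)).Vbad) Frd IsoF Ob realify Strip IsoS Mv)
  (split : SplittingMonoids Mv) {ObΔ : Type} {N : ∀ v : (thetaIndex (pilotDataOfK D K)).V, v ∈ (thetaIndex (pilotDataOfK D K)).Vbad → Type}
  [∀ v h, Monoid (N v h)] (qData : QPilotData ObΔ N)
  (tq : ∀ (pp : Nat.Primes) (x : (thetaIndex (pilotDataOfK D K)).Fibre (.inr pp)),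
    haveI : Fact (pp : ℕ).Prime := ⟨pp.2⟩; kOf (pilotDataOfK D K) pp.1 x)
  (t : ∀ (pp : Nat.Primes) (_ : Fin (pilotDataOfK D K).lstar) (x : (thetaIndex (pilotDataOfK D K)).Fibre (.inr pp)),
    haveI : Fact (pp : ℕ).Prime := ⟨pp.2⟩; kOf (pilotDataOfK D K) pp.1 x)
  (htq0 : ∀ pp x, tq pp x ≠ 0)
  (htq1 : ∀ (pp : Nat.Primes) (x : (thetaIndex (pilotDataOfK D K)).Fibre (.inr pp)),
    haveI : Fact (pp : ℕ).Prime := ⟨pp.2⟩; placeOf (pilotDataOfK D K) pp.1 x ∉ (pilotDataOfK D K).S → ‖tq pp x‖ = 1)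
  (ht0 : ∀ pp i x, t pp i x ≠ 0)
  (ht : ∀ (pp : Nat.Primes) (i : Fin (pilotDataOfK D K).lstar) (x : (thetaIndex (pilotDataOfK D K)).Fibre (.inr pp)),
    haveI : Fact (pp : ℕ).Prime := ⟨pp.2⟩
    Real.log ‖t pp i x‖ = -((pilotDataOfK D K).thetaPilot i (placeOf (pilotDataOfK D K) pp.1 x)) *
      logNorm K (placeOf (pilotDataOfK D K) pp.1 x) / localDegree K (placeOf (pilotDataOfK D K) pp.1 x))
  (htq : ∀ (pp : Nat.Primes) (x : (thetaIndex (pilotDataOfK D K)).Fibre (.inr pp)),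
    haveI : Fact (pp : ℕ).Prime := ⟨pp.2⟩
    Real.log ‖tq pp x‖ = -((pilotDataOfK D K).qPilot (placeOf (pilotDataOfK D K) pp.1 x)) *
      logNorm K (placeOf (pilotDataOfK D K) pp.1 x) / localDegree K (placeOf (pilotDataOfK D K) pp.1 x))

include ht0 ht htq in
/-- **`Σ₅ ⊆ Σ₄`**: abc-iut-rh-typ-5's tame stratum is licensed (`licenceOn_sigmaFive`, p472055), and Σ₄ contains every licensed stratum
(`subset_sigmaNu_of_licenceOn`, gen 0). [claim: Mochizuki2012, status: disputed] -/
theorem sigmaFive_subset_sigmaNu :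
    sigmaFive D ⊆ sigmaNu (pilotDataOfK D K) hlog M archPk archSub Ψ act Mmod region n lat sig split qData tq t htq0 htq1 :=
  subset_sigmaNu_of_licenceOn (pilotDataOfK D K) hlog M archPk archSub Ψ act Mmod region n lat sig split qData tq t htq0 htq1 ht0
    (licenceOn_sigmaFive D hlog M archPk archSub Ψ act Mmod region n lat sig split qData tq t htq0 htq1 ht0 ht htq)

include ht0 ht htq in
/-- **`Σ₅♭ ⊆ Σ₄`**: the ball stratum is licensed too (`licenceOn_sigmaFiveBall`, p473920). [claim: Mochizuki2012, status: disputed] -/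
theorem sigmaFiveBall_subset_sigmaNu :
    sigmaFiveBall D ⊆ sigmaNu (pilotDataOfK D K) hlog M archPk archSub Ψ act Mmod region n lat sig split qData tq t htq0 htq1 :=
  subset_sigmaNu_of_licenceOn (pilotDataOfK D K) hlog M archPk archSub Ψ act Mmod region n lat sig split qData tq t htq0 htq1 ht0
    (licenceOn_sigmaFiveBall D hlog M archPk archSub Ψ act Mmod region n lat sig split qData tq t htq0 htq1 ht0 ht htq)

include ht0 ht htq in
/-- **ROWS 4 AND 5 PAY THE SAME: `R_{Σ₅} = R_{Σ₄}`.** [claim: Mochizuki2012, status: disputed] -/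
theorem offRemainder_sigmaFive_eq_sigmaNu :
    offRemainder (settingPrVolSharp (pilotDataOfK D K) hlog M archPk archSub Ψ act Mmod region n lat sig split qData tq t htq0 htq1)
        (sigmaFive D) =
      offRemainder (settingPrVolSharp (pilotDataOfK D K) hlog M archPk archSub Ψ act Mmod region n lat sig split qData tq t htq0 htq1)
        (sigmaNu (pilotDataOfK D K) hlog M archPk archSub Ψ act Mmod region n lat sig split qData tq t htq0 htq1) :=
  offRemainder_eq_offRemainder_sigmaNu_of_licenceOn (pilotDataOfK D K) hlog M archPk archSub Ψ act Mmod region n lat sig split qData tq t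
    htq0 htq1 ht0 (fun pp i x hx => norm_eq_one_of_realises (pilotDataOfK D K) t ht0 ht pp i x hx)
    (licenceOn_sigmaFive D hlog M archPk archSub Ψ act Mmod region n lat sig split qData tq t htq0 htq1 ht0 ht htq)

include ht0 ht htq in
/-- **`R_{Σ₅♭} = R_{Σ₄}`.** [claim: Mochizuki2012, status: disputed] -/
theorem offRemainder_sigmaFiveBall_eq_sigmaNu :
    offRemainder (settingPrVolSharp (pilotDataOfK D K) hlog M archPk archSub Ψ act Mmod region n lat sig split qData tq t htq0 htq1)
        (sigmaFiveBall D) =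
      offRemainder (settingPrVolSharp (pilotDataOfK D K) hlog M archPk archSub Ψ act Mmod region n lat sig split qData tq t htq0 htq1)
        (sigmaNu (pilotDataOfK D K) hlog M archPk archSub Ψ act Mmod region n lat sig split qData tq t htq0 htq1) :=
  offRemainder_eq_offRemainder_sigmaNu_of_licenceOn (pilotDataOfK D K) hlog M archPk archSub Ψ act Mmod region n lat sig split qData tq t
    htq0 htq1 ht0 (fun pp i x hx => norm_eq_one_of_realises (pilotDataOfK D K) t ht0 ht pp i x hx)
    (licenceOn_sigmaFiveBall D hlog M archPk archSub Ψ act Mmod region n lat sig split qData tq t htq0 htq1 ht0 ht htq)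

include ht0 ht htq in
/-- **`R_{Σ₅♭} = R_{Σ₅}`** (abc-iut-rh-typ-5's `offRemainder_sigmaFiveBall_le_sigmaFive` upgraded to an equality: the ball enlargement of the tame
stratum changes the remainder's support, not its value). [claim: Mochizuki2012, status: disputed] -/
theorem offRemainder_sigmaFiveBall_eq_sigmaFive :
    offRemainder (settingPrVolSharp (pilotDataOfK D K) hlog M archPk archSub Ψ act Mmod region n lat sig split qData tq t htq0 htq1)
        (sigmaFiveBall D) =
      offRemainder (settingPrVolSharp (pilotDataOfK D K) hlog M archPk archSub Ψ act Mmod region n lat sig split qData tq t htq0 htq1)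
        (sigmaFive D) := by
  rw [offRemainder_sigmaFiveBall_eq_sigmaNu D hlog M archPk archSub Ψ act Mmod region n lat sig split qData tq t htq0 htq1 ht0 ht htq,
    offRemainder_sigmaFive_eq_sigmaNu D hlog M archPk archSub Ψ act Mmod region n lat sig split qData tq t htq0 htq1 ht0 ht htq]

include ht0 ht htq in
/-- **`R_{Σ₅} = R_∅`**: row 5's number is the total positive deficit as well. [claim: Mochizuki2012, status: disputed] -/
theorem offRemainder_sigmaFive_eq_offRemainder_empty :
    offRemainder (settingPrVolSharp (pilotDataOfK D K) hlog M archPk archSub Ψ act Mmod region n lat sig split qData tq t htq0 htq1)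
        (sigmaFive D) =
      offRemainder (settingPrVolSharp (pilotDataOfK D K) hlog M archPk archSub Ψ act Mmod region n lat sig split qData tq t htq0 htq1) ∅ :=
  offRemainder_eq_offRemainder_empty_of_licenceOn
    (bridgeHyps_settingPrVolSharp_of_ideles (pilotDataOfK D K) hlog M archPk archSub Ψ act Mmod region n lat sig split qData t tq ht0
      (fun pp i x hx => norm_eq_one_of_realises (pilotDataOfK D K) t ht0 ht pp i x hx) htq0 htq1)
    (licenceOn_sigmaFive D hlog M archPk archSub Ψ act Mmod region n lat sig split qData tq t htq0 htq1 ht0 ht htq)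

include ht0 ht htq in
/-- **`R_{Σ₅♭} = R_∅`**: the ball stratum's number is the total positive deficit too (rows 3 ⊇ 4 ⊇ 5♭ ⊇ 5 as strata: compose with gen 0's
`sigmaNu_subset_sigmaED` for `Σ₄ ⊆ Σ₃`). [claim: Mochizuki2012, status: disputed] -/
theorem offRemainder_sigmaFiveBall_eq_offRemainder_empty :
    offRemainder (settingPrVolSharp (pilotDataOfK D K) hlog M archPk archSub Ψ act Mmod region n lat sig split qData tq t htq0 htq1)
        (sigmaFiveBall D) =
      offRemainder (settingPrVolSharp (pilotDataOfK D K) hlog M archPk archSub Ψ act Mmod region n lat sig split qData tq t htq0 htq1) ∅ :=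
  offRemainder_eq_offRemainder_empty_of_licenceOn
    (bridgeHyps_settingPrVolSharp_of_ideles (pilotDataOfK D K) hlog M archPk archSub Ψ act Mmod region n lat sig split qData t tq ht0
      (fun pp i x hx => norm_eq_one_of_realises (pilotDataOfK D K) t ht0 ht pp i x hx) htq0 htq1)
    (licenceOn_sigmaFiveBall D hlog M archPk archSub Ψ act Mmod region n lat sig split qData tq t htq0 htq1 ht0 ht htq)

end RowFive

/-! ## §3. T-LEVEL at the CHOSEN realising ideles of the window certificates: one number `R_∅(T)` for every abc-end of record -/

section Chosen

open Literature.NumberTheory.DiophantineGeometry.GenEll Summit.ABC.ABC.Theorems Summit.ABC.IUTFork.Conditional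

/-- **`R_{Σ₄}(T) = R_∅(T)` at the chosen realising ideles** — the rewrite along which every abc-end of record (gen 0's `abc_of_offRemainder_sigmaNu_le_tol`
/ `…_tolSharp` / `…_window` / `…_rho_window`, the general-Σ `abc_of_licenceOn_of_offRemainder_le_tol`) reads its [TOL] binder as a tolerance on the ONE
datum number `R_∅(T)`. [claim: Mochizuki2012, status: disputed] -/
theorem offRemainder_sigmaNu_chosen_eq_offRemainder_empty {P : NFPoint} {l : ℕ} (T : Cor22.ThetaVolumeDatumAt P l) :
    letI := T.instFieldF; letI := T.instNumberFieldF; letI := T.instAlgebraF; letI := T.instFieldK;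
        letI := T.instNumberFieldK; letI := T.instAlgebraK; letI := T.instFieldFbar; letI := T.instAlgebraFbar;
        letI := T.instAlgebraKFbar; letI := T.instIsElliptic;
    ∀ (M : Type) [Field M] [NumberField M]
      (archPk : ∀ (j : (thetaIndex (pilotDataOfK T.D T.K)).Label) (vQ : (thetaIndex (pilotDataOfK T.D T.K)).VQ),
        Set ((logShellsDH (pilotDataOfK T.D T.K) (analyticLogv T.K)).Packet j vQ))
      (archSub : ∀ (j : (thetaIndex (pilotDataOfK T.D T.K)).Label) (v : (thetaIndex (pilotDataOfK T.D T.K)).V),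
        Set ((logShellsDH (pilotDataOfK T.D T.K) (analyticLogv T.K)).Packet j ((thetaIndex (pilotDataOfK T.D T.K)).over v)))
      (Ψ : ℤ → ∀ v : (thetaIndex (pilotDataOfK T.D T.K)).V, v ∈ (thetaIndex (pilotDataOfK T.D T.K)).Vbad →
        Set ((logShellsDH (pilotDataOfK T.D T.K) (analyticLogv T.K)).StarPacket v))
      (act : ℤ → ∀ v : (thetaIndex (pilotDataOfK T.D T.K)).V, v ∈ (thetaIndex (pilotDataOfK T.D T.K)).Vbad →
        (logShellsDH (pilotDataOfK T.D T.K) (analyticLogv T.K)).StarPacket v →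
          Module.End ℚ ((logShellsDH (pilotDataOfK T.D T.K) (analyticLogv T.K)).StarPacket v))
      (Mmod : ℤ → ∀ j : (thetaIndex (pilotDataOfK T.D T.K)).LabelStar,
        Set ((logShellsDH (pilotDataOfK T.D T.K) (analyticLogv T.K)).GlobalPacket j.1))
      (region : ℤ → ∀ j : (thetaIndex (pilotDataOfK T.D T.K)).LabelStar, FinDivisor M →
        ∀ vQ : (thetaIndex (pilotDataOfK T.D T.K)).VQ, Set ((logShellsDH (pilotDataOfK T.D T.K) (analyticLogv T.K)).Packet j.1 vQ))
      (n : ℤ) {HT : Type} {LogLink : HT → HT → Type} {IsFull : ∀ {s t : HT}, LogLink s t → Prop}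
      (lat : LGPGaussianLogThetaLattice LogLink IsFull)
      {Frd : Type} {IsoF : Frd → Frd → Type} {Ob : Frd → Type} {realify : Frd → Frd} {Strip : Type}
      {IsoS : Strip → Strip → Type}
      {Mv : ∀ v : (thetaIndex (pilotDataOfK T.D T.K)).V, v ∈ (thetaIndex (pilotDataOfK T.D T.K)).Vbad → Type}
      [∀ v h, Monoid (Mv v h)]
      (sig : GlobalLGPFrobenioidSignature (thetaIndex (pilotDataOfK T.D T.K)).lstar (thetaIndex (pilotDataOfK T.D T.K)).V
        (· ∈ (thetaIndex (pilotDataOfK T.D T.K)).Vbad) Frd IsoF Ob realify Strip IsoS Mv)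
      (split : SplittingMonoids Mv) {ObΔ : Type}
      {N : ∀ v : (thetaIndex (pilotDataOfK T.D T.K)).V, v ∈ (thetaIndex (pilotDataOfK T.D T.K)).Vbad → Type} [∀ v h, Monoid (N v h)]
      (qData : QPilotData ObΔ N),
      offRemainder
          (settingPrVolSharp (pilotDataOfK T.D T.K) (logvAnalytic_analyticLogv (F := T.K)) M archPk archSub Ψ act Mmod region n lat
            sig split qData (exists_realising_qIdeles_pilotDataOfK T.D).choose (exists_realising_thetaIdeles_pilotDataOfK T.D).choose
            (exists_realising_qIdeles_pilotDataOfK T.D).choose_spec.1 (exists_realising_qIdeles_pilotDataOfK T.D).choose_spec.2.1)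
          (sigmaNu (pilotDataOfK T.D T.K) (logvAnalytic_analyticLogv (F := T.K)) M archPk archSub Ψ act Mmod region n lat sig split
            qData (exists_realising_qIdeles_pilotDataOfK T.D).choose (exists_realising_thetaIdeles_pilotDataOfK T.D).choose
            (exists_realising_qIdeles_pilotDataOfK T.D).choose_spec.1 (exists_realising_qIdeles_pilotDataOfK T.D).choose_spec.2.1) =
        offRemainder
          (settingPrVolSharp (pilotDataOfK T.D T.K) (logvAnalytic_analyticLogv (F := T.K)) M archPk archSub Ψ act Mmod region n lat
            sig split qData (exists_realising_qIdeles_pilotDataOfK T.D).choose (exists_realising_thetaIdeles_pilotDataOfK T.D).choose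
            (exists_realising_qIdeles_pilotDataOfK T.D).choose_spec.1 (exists_realising_qIdeles_pilotDataOfK T.D).choose_spec.2.1) ∅ := by
  intro M _ _ archPk archSub Ψ act Mmod region n HT LogLink IsFull lat Frd IsoF Ob realify Strip IsoS Mv _ sig split ObΔ N _ qData
  letI := T.instFieldF; letI := T.instNumberFieldF; letI := T.instAlgebraF; letI := T.instFieldK
  letI := T.instNumberFieldK; letI := T.instAlgebraK; letI := T.instFieldFbar; letI := T.instAlgebraFbar
  letI := T.instAlgebraKFbar; letI := T.instIsElliptic
  exact offRemainder_sigmaNu_eq_offRemainder_empty (pilotDataOfK T.D T.K) (logvAnalytic_analyticLogv (F := T.K)) M archPk archSub Ψ act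
    Mmod region n lat sig split qData (exists_realising_qIdeles_pilotDataOfK T.D).choose (exists_realising_thetaIdeles_pilotDataOfK T.D).choose
    (exists_realising_qIdeles_pilotDataOfK T.D).choose_spec.1 (exists_realising_qIdeles_pilotDataOfK T.D).choose_spec.2.1
    (exists_realising_thetaIdeles_pilotDataOfK T.D).choose_spec.1 (exists_realising_thetaIdeles_pilotDataOfK T.D).choose_spec.2.1

/-- **[NUM∅] — Cor. 3.12 up to the TOTAL POSITIVE DEFICIT at EVERY genuine Θ-volume datum, at the chosen realising ideles: `−|log(q)|(T) ≤ −|log(Θ)|(T)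
+ R_∅(T)`** — no stratum, no S_H, no H⋆, no admissibility guard (gen 0's `cor312UpTo_sigmaNu_chosen` ∘ `R_{Σ₄} = R_∅`). The one number every row's
«S|Σ ⟹ weakened Cor 3.12 ⟹ abc» sentence is about. [cite: Mochizuki2012, IUTchIII Cor. 3.12 p. 173–174] [claim: Mochizuki2012, status: disputed] -/
theorem cor312UpTo_offRemainder_empty_chosen {P : NFPoint} {l : ℕ} (T : Cor22.ThetaVolumeDatumAt P l) :
    letI := T.instFieldF; letI := T.instNumberFieldF; letI := T.instAlgebraF; letI := T.instFieldK;
        letI := T.instNumberFieldK; letI := T.instAlgebraK; letI := T.instFieldFbar; letI := T.instAlgebraFbar;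
        letI := T.instAlgebraKFbar; letI := T.instIsElliptic;
    ∀ (M : Type) [Field M] [NumberField M]
      (archPk : ∀ (j : (thetaIndex (pilotDataOfK T.D T.K)).Label) (vQ : (thetaIndex (pilotDataOfK T.D T.K)).VQ),
        Set ((logShellsDH (pilotDataOfK T.D T.K) (analyticLogv T.K)).Packet j vQ))
      (archSub : ∀ (j : (thetaIndex (pilotDataOfK T.D T.K)).Label) (v : (thetaIndex (pilotDataOfK T.D T.K)).V),
        Set ((logShellsDH (pilotDataOfK T.D T.K) (analyticLogv T.K)).Packet j ((thetaIndex (pilotDataOfK T.D T.K)).over v)))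
      (Ψ : ℤ → ∀ v : (thetaIndex (pilotDataOfK T.D T.K)).V, v ∈ (thetaIndex (pilotDataOfK T.D T.K)).Vbad →
        Set ((logShellsDH (pilotDataOfK T.D T.K) (analyticLogv T.K)).StarPacket v))
      (act : ℤ → ∀ v : (thetaIndex (pilotDataOfK T.D T.K)).V, v ∈ (thetaIndex (pilotDataOfK T.D T.K)).Vbad →
        (logShellsDH (pilotDataOfK T.D T.K) (analyticLogv T.K)).StarPacket v →
          Module.End ℚ ((logShellsDH (pilotDataOfK T.D T.K) (analyticLogv T.K)).StarPacket v))
      (Mmod : ℤ → ∀ j : (thetaIndex (pilotDataOfK T.D T.K)).LabelStar,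
        Set ((logShellsDH (pilotDataOfK T.D T.K) (analyticLogv T.K)).GlobalPacket j.1))
      (region : ℤ → ∀ j : (thetaIndex (pilotDataOfK T.D T.K)).LabelStar, FinDivisor M →
        ∀ vQ : (thetaIndex (pilotDataOfK T.D T.K)).VQ, Set ((logShellsDH (pilotDataOfK T.D T.K) (analyticLogv T.K)).Packet j.1 vQ))
      (n : ℤ) {HT : Type} {LogLink : HT → HT → Type} {IsFull : ∀ {s t : HT}, LogLink s t → Prop}
      (lat : LGPGaussianLogThetaLattice LogLink IsFull)
      {Frd : Type} {IsoF : Frd → Frd → Type} {Ob : Frd → Type} {realify : Frd → Frd} {Strip : Type}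
      {IsoS : Strip → Strip → Type}
      {Mv : ∀ v : (thetaIndex (pilotDataOfK T.D T.K)).V, v ∈ (thetaIndex (pilotDataOfK T.D T.K)).Vbad → Type}
      [∀ v h, Monoid (Mv v h)]
      (sig : GlobalLGPFrobenioidSignature (thetaIndex (pilotDataOfK T.D T.K)).lstar (thetaIndex (pilotDataOfK T.D T.K)).V
        (· ∈ (thetaIndex (pilotDataOfK T.D T.K)).Vbad) Frd IsoF Ob realify Strip IsoS Mv)
      (split : SplittingMonoids Mv) {ObΔ : Type}
      {N : ∀ v : (thetaIndex (pilotDataOfK T.D T.K)).V, v ∈ (thetaIndex (pilotDataOfK T.D T.K)).Vbad → Type} [∀ v h, Monoid (N v h)]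
      (qData : QPilotData ObΔ N),
      T.negAbsLogQ ≤ T.negLogTheta +
        offRemainder
          (settingPrVolSharp (pilotDataOfK T.D T.K) (logvAnalytic_analyticLogv (F := T.K)) M archPk archSub Ψ act Mmod region n lat
            sig split qData (exists_realising_qIdeles_pilotDataOfK T.D).choose (exists_realising_thetaIdeles_pilotDataOfK T.D).choose
            (exists_realising_qIdeles_pilotDataOfK T.D).choose_spec.1 (exists_realising_qIdeles_pilotDataOfK T.D).choose_spec.2.1) ∅ := by
  intro M _ _ archPk archSub Ψ act Mmod region n HT LogLink IsFull lat Frd IsoF Ob realify Strip IsoS Mv _ sig split ObΔ N _ qData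
  have h := cor312UpTo_sigmaNu_chosen T M archPk archSub Ψ act Mmod region n lat sig split qData
  have he := offRemainder_sigmaNu_chosen_eq_offRemainder_empty T M archPk archSub Ψ act Mmod region n lat sig split qData
  rw [he] at h
  exact h

end Chosen

end Summit.ABC.IUTFork.Repair.RH.SigmaStrataEq

end
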